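import Literature.MathematicalPhysics.QuantumFieldTheory.Balaban1983to89.B9Ineq349WordDiffHom
import Literature.MathematicalPhysics.QuantumFieldTheory.Balaban1983to89.B9Eq376ProjPieceDictY
import Literature.MathematicalPhysics.QuantumFieldTheory.Balaban1983to89.B9GeoNormsKLevelV1
import Literature.MathematicalPhysics.QuantumFieldTheory.Balaban1983to89.B9Eq3104CutoffCommutators
import Literature.MathematicalPhysics.QuantumFieldTheory.Balaban1983to89.B9Ineq347BondReadingYInv
import Literature.MathematicalPhysics.QuantumFieldTheory.Balaban1983to89.B9CubeLettersInvWriteDictB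

/-!
# `Balaban1983to89.B9B8KnitBondWordDiff` — [Balaban1985BackgroundPropagators] (3.26) p. 395 AT TWO SITE-TRANSPORTER LETTERS: the block majorant of
# `Δ_a(U; par₁, G′₁) − Δ_a(U; par₂, G′₂) = D_U(R(par₁) − R(par₂))D*_U` over the member's blocks FROM the member-level letter majorants at the two tables
# and the three small differenced letters — FILE 2a's letter-free engine read in def-Y's letters (junction J-B, bond sector, FILE 2b; consumer: t2s-1 g10's
# bootstrap `B9B8KnitBondResolvent` ∕ FILE 3 at `(par₁, par₂) = (parSymY, parKnitY)`; the displayed member-level inputs are discharged by FILE 2c from the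
# junction files 8∕9∕10∕23a–c and modules M5.5∕M5.6)

T. Bałaban, *Propagators for lattice gauge theories in a background field*, Commun. Math. Phys. **99** (1985) 389–434
[`Balaban1985BackgroundPropagators`, "B9"]; [4] = T. Bałaban, *Propagators and renormalization transformations for lattice gauge
theories. II*, Commun. Math. Phys. **96** (1984) 223–250 [`Balaban1984PropagatorsII`].

statement-level skeleton of published theorems with citation tags; proofs where landed; nothing here is a claim about the
Yang–Mills mass gap

THE PRINTED LOCUS (verbatim up to notation; page owner r06).  (3.25) p. 394–395 «Rf = (I − G′Q′\*(Q′G′²Q′\*)⁻¹Q′G′)f»; (3.26) p. 395 «Δ_a = Δ + DRD\* + Q\*aQ»;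
(3.27) p. 395 «G(U) = Δ_a(U)⁻¹»; (3.49) p. 399 (the `DPD*` entry «O(1)(Lʲη)⁻²(L^{j′}η)^{−d}e^{−(1/2)δ₀d(y,y′)}» «using again Lemma 2.1»); (3.19) p. 393 vs (3.40)
p. 397 (print has ONE transporter convention); (3.106) p. 414 («G = G₀(I − R)⁻¹» — the resolvent device by which the junction is priced); [4] (2.50)–(2.55)
p. 232, Lemma 2.1 (2.60)–(2.61) p. 234.

WHY THIS FILE (cell `lit-balaban`; seat p38 gen 46; lead g34 RULING JUNCTION-PARS (T) CONFIRMED 2026-08-28T23:20Z; t2s-1 g10 `JB-BOND-DESIGN.md`).  t2s-1's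
FILE 1 reduces the bond-sector junction between def-Y's transporter of record `parSymY` (at which M5.1b-G → M5.7 are typed) and the knit's `parKnitY` (forced
by the Landau condition (1.38)) to ONE located estimate: a block majorant of `E = Δ_a(U; parKnitY) − Δ_a(U; parSymY)`.  By (3.26) the Laplacian and
`Q*aQ` cancel and `E = D_U(R₁ − R₂)D*_U = −D_U(W₁ − W₂)D*_U`, `W_j = G′_jQ′*_jX_j⁻¹Q′_jG′_j` the (3.25) word at table `j`.  FILE 2a
(`B9Ineq349WordDiffHom.hasMajorant_wordDiff349`) bounds the difference of the two words between abstract derivative letters from letter majorants of the printed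
shapes at the two tables plus the three small differenced letters.  THIS FILE reads that engine in def-Y's letters at the MEMBER: the realified letters
`conj b(η²G′_j)`, `conĵQ′_j`, `conĵQ′*_j`, `conj b(η⁻⁴X_j⁻¹)` (the `η`-units cancel, §1), the two-space derivative letters `conĵ(D)`, `conĵ(D*)` of r06's
`B9Eq376POneLetters` at the unit `|c_f| = η⁻¹`, p38 g43's carrier relabelling (`B9Eq376ProjPieceDictY`: `(direction, site) ↔ bond`), and the (3.26) cancellation,
giving ★★★ the member-side majorant `conj b((Δ_a(U;par₁,G′₁) − Δ_a(U;par₂,G′₂))^ℝ) ≺ κ_diff·ℓ(a)⁻²·e^{−ρd}` over `(toB6 (geo9K i) Rr Hp, ιB∘blkV1)` — ANY two tables,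
any `U`, any coefficient algebra; the member-level letter majorants are DISPLAYED (at `(parSymY, parKnitY)` FILE 2c discharges them: `G′` plain∕left∕right
entries at `parSymY` from M5.5, at `parKnitY` from junction files 9∕10, `Δ′_sym − Δ′_knit` block-diagonal from file 8, `Q′`-differences from file 23a, `X`
difference from 23b, `X⁻¹` at the knit letter from 23c, geometry from D4's `scaleTransfer_len_geo9K` and the member's (2.61)).

WHAT THIS FILE PROVES (THEOREMS; 0 `def`, 0 `def … : Prop`, 0 sorry; standard axioms).
* §1 `pWord_conj_eq` (`conj b(η²G^ℝ)∘conĵ(Q*^ℝ)∘conj b(η⁻⁴X⁻¹^ℝ)∘conĵ(Q^ℝ)∘conj b(η²G′^ℝ) = conj b((G∘Q*∘X⁻¹∘Q∘G′)^ℝ)` for abstract ℂ-linear letters — the `η`-units cancel),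
  `dWord_conj_eq` (the same between `conĵ(D)`, `conĵ(D*)`), `deltaAY_sub_eq` (`Δ_a(par₁,G′₁) − Δ_a(par₂,G′₂) = −D_U(W₁ − W₂)D*_U`, (3.26)).
* §2 ★★★ `hasMajorant_conj_deltaAY_sub` — for any two tables `(par₁, G′₁)`, `(par₂, G′₂)`: from the member-level majorants over `toB6 (geo9K i) Rr Hp` of the left
  entry `conĵ(D)∘conj b(η²G′₂(U)) ≺ B_Xℓe^{−δd}`, of the difference of the two left entries `≺ θ_Xℓe^{−δd}`, of the right entry `conj b(η²G′₁(U))∘conĵ(D*) ≺ B_Yℓe^{−δd}`,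
  of the difference of the right entries `≺ θ_Yℓe^{−δd}`, of `conĵQ′_j(U)`, `conĵQ′*_j(U)` (`κ_Q𝟙`) and their differences (`θ_Q𝟙`), of `conj b(η⁻⁴X_j⁻¹(U))`
  (`B₁ℓ⁻⁴e^{−δd}`) and their difference (`θ_Cℓ⁻⁴e^{−δd}`), (2.54), (2.61) at `β`, the transfers of `ℓ`, `ℓ⁻⁴` at `α`, `ρ + (2α+β)δ₀ ≤ δ`:
  `conj b((Δ_a(U;par₁,G′₁) − Δ_a(U;par₂,G′₂))^ℝ) ≺ Λ⁴c₁²(κ_Q²θ_XB₁B_Y + κ_Qθ_QB_XB₁B_Y + κ_Q²B_Xθ_CB_Y + κ_Qθ_QB_XB₁B_Y + κ_Q²B_XB₁θ_Y)·((geo9K i).len a ^ 2)⁻¹·e^{−ρ·d(a,a′)}`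
  over `(toB6 (geo9K i) Rr Hp, fun p => ιB (blkV1 i.hN i.D p.1))` — t2s-1's (Q1) currency.

HONEST SCOPE ∕ NOT CLAIMED.  Identity plumbing + FILE 2a; all member-level letter majorants are HYPOTHESES (FILE 2c); block-majorant (operator) form; any `𝔸`,
any two tables (the junction uses `(parSymY, parKnitY)` with table-2 letters LEFT of each differenced letter, so that only LEFT entries at the knit letter and
RIGHT entries at the letter of record are needed).  Print has one transporter convention; the junction is a formalisation artefact.  NOT a node discharge; no
summit ∕ sub-problem statement is proved; nothing continuum ∕ OS ∕ mass-gap ∕ Clay; YM mass gap NOT proved by any of this (Track A conditional rung).  No `sorry`,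
no `axiom`, no `… : Prop` fact, no `instance`, no `notation`, no `def`.  NEW file; nothing landed is modified.  `--supports stmt-QuantumFields-19200` as helper.
Net new unproved facts: 0.

RELATED IN THE TREE, NOT DUPLICATED (searched 2026-08-28: `rg 'deltaAY .* - deltaAY|KnitBond' Literature/` = ∅ in the tree (t2s-1's FILE 1 `B9B8KnitBondResolvent`
in flight: its `deltaAY_sub_deltaAY` is the same one-line (3.26) cancellation — §1's `deltaAY_sub_eq` restates it in the `−D(W₁ − W₂)D*` orientation this file
needs; if FILE 1 lands first the consumer may use either)): p38 D2a `B9Cor36DPDsCubeAtLocCfg.hasMajorant_conj_gradMdiv_of_relabel` (the one-word relabel at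
the cube — here the member twin is inlined from g43's `hasMajorant_of_relabel` + `conj_gradY_comp_divY_apply_eq`), g43 `B9Eq376ProjPieceDictY.pHatWord_eq_conj`
(the cube-letter original of §1), FILE 2a `B9Ineq349WordDiffHom` (the engine, USED BY NAME).
-/

noncomputable section

namespace Literature.MathematicalPhysics.QuantumFieldTheory.Balaban1983to89.B9B8KnitBondWordDiff

open B6RandomWalk (HasMajorant hasMajorant_mono Triangle254 Ineq261 c1_nonneg)
open B6RandomWalkHom (HasMajorantHom)
open B9Thm34Ext (toB6)
open B9Ineq347 (ScaleTransfer)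
open B9Ineq368PPrime (hasMajorant_neg)
open B9Ineq349WordDiffHom (hasMajorant_wordDiff349)
open B9Eq352DivFormLetters (conj conj_sub conj_neg)
open B9Eq376POneLetters (conjHom conjHom_comp conjHom_eq_conj gradLin divLin)
open B9Eq376ProjPieceDictY (hasMajorant_of_relabel bondRelabelY conj_gradY_comp_divY_apply_eq)
open B6KLevelCensusIndexV1 (KIdx kGeo)
open B6GlobalChartV1 (blkV1)
open B6Geom246MultiLevelBox (blkOf)
open B9GeoNormsKLevelV1 (geo9K geo9K_dist_nonneg)
open B9Cor35GpCubeInputsAtOne (eta_ne_zero)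
open B9Eq3104CutoffCommutators (DPDsY)
open B6Ineq2142KLevelV1 (β)
open B8ScaledSupNorm (weight weight_neg_natCast)
open B9GeoLemma21KLevelV1 (geo9K_len_pos)
open B9Ineq347BondReadingYInv (sum_piece suppIn_piece supNorm_piece_le len_blkB_eqK wNormB_norm_eq_wNormBY)
open B9Ineq347GAAtLetters (wNormBY_le_of_pointwise)
open B9CubeLettersInvReadings (TestY)
open B9CubeLettersInvWriteDictB (norm_apply_le_of_hasMajorant_testYB)
open Node00 (SiteY BlkY IBondY FBondY CfgY SiteParY BondParY SiteOpY shiftY UboxY gradY divY QpY QpsY XinvY RY deltaAY wNormBY)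
open Node00.OpsYNablaBridge (chartY)

variable {d ℓ : ℕ} {hd : 1 ≤ d + 1} {hL : Odd (ℓ + 1) ∧ 1 < ℓ + 1} {b₀ b₁ : ℝ}
variable {𝔸 : Type} [NormedRing 𝔸] [NormedAlgebra ℂ 𝔸] [CompleteSpace 𝔸]
variable {ι : Type} [Fintype ι] (b : Module.Basis ι ℝ 𝔸)

/-! ## §1  The realified (3.25) word between the derivative letters; the (3.26) cancellation -/

section Algebra

variable (i : KIdx d ℓ hd hL b₀ b₁)

omit [CompleteSpace 𝔸] in
/-- **THE `η`-UNITS OF THE (3.25) WORD CANCEL** (`η²·η⁻⁴·η² = 1`), abstract ℂ-linear letters: `conj b(η²G^ℝ) ∘ conĵ(Q*^ℝ) ∘ conj b(η⁻⁴X⁻¹^ℝ) ∘ conĵ(Q^ℝ) ∘ conj b(η²G′^ℝ)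
= conj b((G∘Q*∘X⁻¹∘Q∘G′)^ℝ)` (g43's `pHatWord_eq_conj` for any letters). [cite: Balaban1985BackgroundPropagators, (3.25) p.394; Balaban1984PropagatorsII, (2.51)–(2.52) p.232] -/
theorem pWord_conj_eq {η : ℝ} (hη : η ≠ 0) (G G' : (SiteY i → 𝔸) →ₗ[ℂ] (SiteY i → 𝔸)) (Qs : (BlkY i → 𝔸) →ₗ[ℂ] (SiteY i → 𝔸))
    (Xi : (BlkY i → 𝔸) →ₗ[ℂ] (BlkY i → 𝔸)) (Q : (SiteY i → 𝔸) →ₗ[ℂ] (BlkY i → 𝔸)) :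
    conj b ((η ^ 2) • G.restrictScalars ℝ) ∘ₗ conjHom b (Qs.restrictScalars ℝ) ∘ₗ conj b (((η ^ 4)⁻¹) • Xi.restrictScalars ℝ) ∘ₗ
        conjHom b (Q.restrictScalars ℝ) ∘ₗ conj b ((η ^ 2) • G'.restrictScalars ℝ) =
      conj b ((G ∘ₗ Qs ∘ₗ Xi ∘ₗ Q ∘ₗ G').restrictScalars ℝ) := by
  have h1 : η ^ 2 * (((η ^ 4)⁻¹) * η ^ 2) = 1 := by
    rw [mul_left_comm, ← pow_add, show 2 + 2 = 4 from rfl, inv_mul_cancel₀ (pow_ne_zero 4 hη)]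
  rw [← conjHom_eq_conj, ← conjHom_eq_conj, ← conjHom_eq_conj, ← conjHom_eq_conj, conjHom_comp, conjHom_comp, conjHom_comp, conjHom_comp]
  congr 1
  refine LinearMap.ext fun Φ => ?_
  simp only [LinearMap.comp_apply, LinearMap.smul_apply, LinearMap.restrictScalars_apply, LinearMap.map_smul_of_tower, smul_smul]
  rw [h1, one_smul]

omit [CompleteSpace 𝔸] in
/-- the word BETWEEN THE DERIVATIVE LETTERS: `(conĵD ∘ conj b(η²G)) ∘ conĵQ* ∘ conj b(η⁻⁴X⁻¹) ∘ conĵQ ∘ (conj b(η²G′) ∘ conĵD*) = conĵD ∘ conj b((GQ*X⁻¹QG′)^ℝ) ∘ conĵD*`.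
[cite: Balaban1985BackgroundPropagators, (3.25)–(3.26) p.395; Balaban1984PropagatorsII, (2.52) p.232, bookkeeping] -/
theorem dWord_conj_eq {η : ℝ} (hη : η ≠ 0) (G G' : (SiteY i → 𝔸) →ₗ[ℂ] (SiteY i → 𝔸)) (Qs : (BlkY i → 𝔸) →ₗ[ℂ] (SiteY i → 𝔸))
    (Xi : (BlkY i → 𝔸) →ₗ[ℂ] (BlkY i → 𝔸)) (Q : (SiteY i → 𝔸) →ₗ[ℂ] (BlkY i → 𝔸))
    (DL : (SiteY i × ι → ℝ) →ₗ[ℝ] ((Fin (d + 1) × SiteY i) × ι → ℝ)) (DsL : ((Fin (d + 1) × SiteY i) × ι → ℝ) →ₗ[ℝ] (SiteY i × ι → ℝ)) :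
    (DL ∘ₗ conj b ((η ^ 2) • G.restrictScalars ℝ)) ∘ₗ conjHom b (Qs.restrictScalars ℝ) ∘ₗ conj b (((η ^ 4)⁻¹) • Xi.restrictScalars ℝ) ∘ₗ
        conjHom b (Q.restrictScalars ℝ) ∘ₗ (conj b ((η ^ 2) • G'.restrictScalars ℝ) ∘ₗ DsL) =
      DL ∘ₗ conj b ((G ∘ₗ Qs ∘ₗ Xi ∘ₗ Q ∘ₗ G').restrictScalars ℝ) ∘ₗ DsL := by
  rw [← pWord_conj_eq b i hη G G' Qs Xi Q]
  simp only [LinearMap.comp_assoc]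

/-- **THE (3.26) CANCELLATION**: `Δ_a(U; par₁, G′₁) − Δ_a(U; par₂, G′₂) = −D_U ∘ (W₁ − W₂) ∘ D*_U`, `W_j = G′_jQ′*_jX_j⁻¹Q′_jG′_j` (the Laplacian and `Q*aQ` do not see
the site transporter; `R_j = 1 − W_j`). [cite: Balaban1985BackgroundPropagators, (3.25)–(3.26) p.395] -/
theorem deltaAY_sub_eq (parS₁ parS₂ : SiteParY 𝔸 i) (parB : BondParY 𝔸 i) (Gp₁ Gp₂ : SiteOpY 𝔸 i) (U : CfgY 𝔸 i) :
    deltaAY i parS₁ parB Gp₁ U - deltaAY i parS₂ parB Gp₂ U =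
      -(gradY i U ∘ₗ (Gp₁ U ∘ₗ QpsY i parS₁ U ∘ₗ XinvY i parS₁ Gp₁ U ∘ₗ QpY i parS₁ U ∘ₗ Gp₁ U
          - Gp₂ U ∘ₗ QpsY i parS₂ U ∘ₗ XinvY i parS₂ Gp₂ U ∘ₗ QpY i parS₂ U ∘ₗ Gp₂ U) ∘ₗ divY i U) := by
  simp only [deltaAY, RY, LinearMap.comp_sub, LinearMap.sub_comp]
  abel

/-- the same for the NONLOCAL PARTS: `D_UP₁D*_U − D_UP₂D*_U = D_U ∘ (W₁ − W₂) ∘ D*_U` (`P_j = 1 − R_j = W_j`). [cite: Balaban1985BackgroundPropagators, (3.25)–(3.26) p.395, (3.101) p.414] -/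
theorem DPDsY_sub_eq (parS₁ parS₂ : SiteParY 𝔸 i) (Gp₁ Gp₂ : SiteOpY 𝔸 i) (U : CfgY 𝔸 i) :
    DPDsY i parS₁ Gp₁ U - DPDsY i parS₂ Gp₂ U =
      gradY i U ∘ₗ (Gp₁ U ∘ₗ QpsY i parS₁ U ∘ₗ XinvY i parS₁ Gp₁ U ∘ₗ QpY i parS₁ U ∘ₗ Gp₁ U
          - Gp₂ U ∘ₗ QpsY i parS₂ U ∘ₗ XinvY i parS₂ Gp₂ U ∘ₗ QpY i parS₂ U ∘ₗ Gp₂ U) ∘ₗ divY i U := by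
  simp only [DPDsY, RY, LinearMap.comp_sub, LinearMap.sub_comp]
  abel

/-- hence `Δ_a(U;par₁,G′₁) − Δ_a(U;par₂,G′₂) = −(D_UP₁D*_U − D_UP₂D*_U)` (t2s-1's `deltaAY_sub_deltaAY_eq_DPDsY_sub`, either orientation). [cite: Balaban1985BackgroundPropagators, (3.26) p.395, (3.101) p.414] -/
theorem deltaAY_sub_eq_neg_DPDsY_sub (parS₁ parS₂ : SiteParY 𝔸 i) (parB : BondParY 𝔸 i) (Gp₁ Gp₂ : SiteOpY 𝔸 i) (U : CfgY 𝔸 i) :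
    deltaAY i parS₁ parB Gp₁ U - deltaAY i parS₂ parB Gp₂ U = -(DPDsY i parS₁ Gp₁ U - DPDsY i parS₂ Gp₂ U) := by
  rw [deltaAY_sub_eq, DPDsY_sub_eq]

end Algebra

/-! ## §2  ★★★ The member-side majorant of `conj b(Δ_a(U;par₁,G′₁) − Δ_a(U;par₂,G′₂))` from the member-level letters -/

section Member

variable (i : KIdx d ℓ hd hL b₀ b₁) (ιB : BlkY i → IBondY i)

/-- ★★★ **THE BLOCK MAJORANT OF `D_UP₁D*_U − D_UP₂D*_U = −(Δ_a(U; par₁, G′₁) − Δ_a(U; par₂, G′₂))` OVER THE MEMBER's BLOCKS** — FILE 2a's engine in def-Y's letters.  Realified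
letters at the member (`η = (kGeo i).eta = |c_f|⁻¹`): left entries `X_j := conĵ(D_U) ∘ conj b(η²G′_j(U))` (sites → (direction, site) pairs), right entries
`Y_j := conj b(η²G′_j(U)) ∘ conĵ(D*_U)`, `Q_j := conĵQ′(U;par_j)`, `Q*_j := conĵQ′*(U;par_j)`, `C_j := conj b(η⁻⁴X(U;par_j,G′_j)⁻¹)`.  HYPOTHESES (member level, over
`toB6 (geo9K i) Rr Hp` with def-Y's block maps): `X₂ ≺ B_Xℓe^{−δd}`, `X₁ − X₂ ≺ θ_Xℓe^{−δd}`, `Y₁ ≺ B_Yℓe^{−δd}`, `Y₁ − Y₂ ≺ θ_Yℓe^{−δd}`, `Q_j, Q*_j ≺ κ_Q𝟙`, `Q₁ − Q₂, Q*₁ − Q*₂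
≺ θ_Q𝟙`, `C_j ≺ B₁ℓ⁻⁴e^{−δd}`, `C₁ − C₂ ≺ θ_Cℓ⁻⁴e^{−δd}`; (2.54), (2.61) at `β`, the transfers of `ℓ`, `ℓ⁻⁴` at `α` (`Λ ≥ 1`), `ρ + (2α+β)δ₀ ≤ δ`.  CONCLUSION:
`conj b((D_UP₁D*_U − D_UP₂D*_U)^ℝ) ≺ Λ⁴c₁²(κ_Q²θ_XB₁B_Y + κ_Qθ_QB_XB₁B_Y + κ_Q²B_Xθ_CB_Y + κ_Qθ_QB_XB₁B_Y + κ_Q²B_XB₁θ_Y)·((geo9K i).len a ^ 2)⁻¹·e^{−ρd(a,a′)}`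
over `(toB6 (geo9K i) Rr Hp, fun p => ιB (blkV1 i.hN i.D p.1))`.  At `(par₁, par₂) = (parSymY, parKnitY)` this is t2s-1's `E = Δ_a(knit) − Δ_a(sym)` on the nose
(§1 `deltaAY_sub_eq_neg_DPDsY_sub`; `hasMajorant_conj_deltaAY_sub` below is the other sign).
[cite: Balaban1985BackgroundPropagators, (3.25)–(3.27) p.395, (3.49) p.399, (3.106) p.414; Balaban1984PropagatorsII, (2.50)–(2.55) p.232, Lemma 2.1 (2.60)–(2.61) p.234] -/
theorem hasMajorant_conj_DPDsY_sub (parS₁ parS₂ : SiteParY 𝔸 i) (Gp₁ Gp₂ : SiteOpY 𝔸 i) (U : CfgY 𝔸 i)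
    (Rr : ℝ) (Hp : Prop) [Fintype (geo9K i).Site] [DecidableEq (geo9K i).Site] (dB : ℕ) (δ₀ δ α β ρ Λ κQ θQ BX θX B₁ θC BY θY : ℝ)
    (hκQ : 0 ≤ κQ) (hθQ : 0 ≤ θQ) (hBX : 0 ≤ BX) (hθX : 0 ≤ θX) (hB₁ : 0 ≤ B₁) (hθC : 0 ≤ θC) (hBY : 0 ≤ BY) (hθY : 0 ≤ θY)
    (hΛ : 1 ≤ Λ) (hρ : 0 ≤ ρ) (hα : 0 ≤ α) (hβ : 0 ≤ β) (hδ₀ : 0 ≤ δ₀) (hr : ρ + (2 * α + β) * δ₀ ≤ δ)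
    (htri : Triangle254 (toB6 (geo9K i) Rr Hp)) (h261 : Ineq261 dB (toB6 (geo9K i) Rr Hp) δ₀ β)
    (hT1 : ScaleTransfer (geo9K i) δ₀ α Λ (fun a => (geo9K i).len a)) (hT4 : ScaleTransfer (geo9K i) δ₀ α Λ (fun a => ((geo9K i).len a ^ 4)⁻¹))
    (hX₂ : HasMajorantHom (g := toB6 (geo9K i) Rr Hp) (fun p : SiteY i × ι => ιB (blkOf i.D.toDomains p.1))
      (fun q : (Fin (d + 1) × SiteY i) × ι => ιB (blkOf i.D.toDomains q.1.2))
      (conjHom b (gradLin (shiftY i) ((|i.cf| : ℝ) : ℂ) (UboxY i U)) ∘ₗ conj b (((kGeo i).eta ^ 2) • (Gp₂ U).restrictScalars ℝ))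
      (fun a a' => BX * (geo9K i).len a * Real.exp (-(δ * (geo9K i).dist a a'))))
    (hdX : HasMajorantHom (g := toB6 (geo9K i) Rr Hp) (fun p : SiteY i × ι => ιB (blkOf i.D.toDomains p.1))
      (fun q : (Fin (d + 1) × SiteY i) × ι => ιB (blkOf i.D.toDomains q.1.2))
      (conjHom b (gradLin (shiftY i) ((|i.cf| : ℝ) : ℂ) (UboxY i U)) ∘ₗ conj b (((kGeo i).eta ^ 2) • (Gp₁ U).restrictScalars ℝ) -
        conjHom b (gradLin (shiftY i) ((|i.cf| : ℝ) : ℂ) (UboxY i U)) ∘ₗ conj b (((kGeo i).eta ^ 2) • (Gp₂ U).restrictScalars ℝ))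
      (fun a a' => θX * (geo9K i).len a * Real.exp (-(δ * (geo9K i).dist a a'))))
    (hY₁ : HasMajorantHom (g := toB6 (geo9K i) Rr Hp) (fun q : (Fin (d + 1) × SiteY i) × ι => ιB (blkOf i.D.toDomains q.1.2))
      (fun p : SiteY i × ι => ιB (blkOf i.D.toDomains p.1))
      (conj b (((kGeo i).eta ^ 2) • (Gp₁ U).restrictScalars ℝ) ∘ₗ conjHom b (divLin (shiftY i) ((|i.cf| : ℝ) : ℂ) (UboxY i U)))
      (fun a a' => BY * (geo9K i).len a * Real.exp (-(δ * (geo9K i).dist a a'))))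
    (hdY : HasMajorantHom (g := toB6 (geo9K i) Rr Hp) (fun q : (Fin (d + 1) × SiteY i) × ι => ιB (blkOf i.D.toDomains q.1.2))
      (fun p : SiteY i × ι => ιB (blkOf i.D.toDomains p.1))
      (conj b (((kGeo i).eta ^ 2) • (Gp₁ U).restrictScalars ℝ) ∘ₗ conjHom b (divLin (shiftY i) ((|i.cf| : ℝ) : ℂ) (UboxY i U)) -
        conj b (((kGeo i).eta ^ 2) • (Gp₂ U).restrictScalars ℝ) ∘ₗ conjHom b (divLin (shiftY i) ((|i.cf| : ℝ) : ℂ) (UboxY i U)))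
      (fun a a' => θY * (geo9K i).len a * Real.exp (-(δ * (geo9K i).dist a a'))))
    (hQ₁ : HasMajorantHom (g := toB6 (geo9K i) Rr Hp) (fun p : SiteY i × ι => ιB (blkOf i.D.toDomains p.1)) (fun q : BlkY i × ι => ιB q.1)
      (conjHom b ((QpY i parS₁ U).restrictScalars ℝ)) (fun a a' : (geo9K i).Site => if a = a' then κQ else 0))
    (hQ₂ : HasMajorantHom (g := toB6 (geo9K i) Rr Hp) (fun p : SiteY i × ι => ιB (blkOf i.D.toDomains p.1)) (fun q : BlkY i × ι => ιB q.1)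
      (conjHom b ((QpY i parS₂ U).restrictScalars ℝ)) (fun a a' : (geo9K i).Site => if a = a' then κQ else 0))
    (hQs₁ : HasMajorantHom (g := toB6 (geo9K i) Rr Hp) (fun q : BlkY i × ι => ιB q.1) (fun p : SiteY i × ι => ιB (blkOf i.D.toDomains p.1))
      (conjHom b ((QpsY i parS₁ U).restrictScalars ℝ)) (fun a a' : (geo9K i).Site => if a = a' then κQ else 0))
    (hQs₂ : HasMajorantHom (g := toB6 (geo9K i) Rr Hp) (fun q : BlkY i × ι => ιB q.1) (fun p : SiteY i × ι => ιB (blkOf i.D.toDomains p.1))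
      (conjHom b ((QpsY i parS₂ U).restrictScalars ℝ)) (fun a a' : (geo9K i).Site => if a = a' then κQ else 0))
    (hdQ : HasMajorantHom (g := toB6 (geo9K i) Rr Hp) (fun p : SiteY i × ι => ιB (blkOf i.D.toDomains p.1)) (fun q : BlkY i × ι => ιB q.1)
      (conjHom b ((QpY i parS₁ U).restrictScalars ℝ) - conjHom b ((QpY i parS₂ U).restrictScalars ℝ)) (fun a a' : (geo9K i).Site => if a = a' then θQ else 0))
    (hdQs : HasMajorantHom (g := toB6 (geo9K i) Rr Hp) (fun q : BlkY i × ι => ιB q.1) (fun p : SiteY i × ι => ιB (blkOf i.D.toDomains p.1))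
      (conjHom b ((QpsY i parS₁ U).restrictScalars ℝ) - conjHom b ((QpsY i parS₂ U).restrictScalars ℝ)) (fun a a' : (geo9K i).Site => if a = a' then θQ else 0))
    (hC₁ : HasMajorant (g := toB6 (geo9K i) Rr Hp) (fun q : BlkY i × ι => ιB q.1)
      (conj b ((((kGeo i).eta ^ 4)⁻¹) • (XinvY i parS₁ Gp₁ U).restrictScalars ℝ))
      (fun a a' => B₁ * ((geo9K i).len a ^ 4)⁻¹ * Real.exp (-(δ * (geo9K i).dist a a'))))
    (hC₂ : HasMajorant (g := toB6 (geo9K i) Rr Hp) (fun q : BlkY i × ι => ιB q.1)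
      (conj b ((((kGeo i).eta ^ 4)⁻¹) • (XinvY i parS₂ Gp₂ U).restrictScalars ℝ))
      (fun a a' => B₁ * ((geo9K i).len a ^ 4)⁻¹ * Real.exp (-(δ * (geo9K i).dist a a'))))
    (hdC : HasMajorant (g := toB6 (geo9K i) Rr Hp) (fun q : BlkY i × ι => ιB q.1)
      (conj b ((((kGeo i).eta ^ 4)⁻¹) • (XinvY i parS₁ Gp₁ U).restrictScalars ℝ) - conj b ((((kGeo i).eta ^ 4)⁻¹) • (XinvY i parS₂ Gp₂ U).restrictScalars ℝ))
      (fun a a' => θC * ((geo9K i).len a ^ 4)⁻¹ * Real.exp (-(δ * (geo9K i).dist a a')))) :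
    HasMajorant (g := toB6 (geo9K i) Rr Hp) (fun p : FBondY i × ι => ιB (blkV1 i.hN i.D p.1))
      (conj b ((DPDsY i parS₁ Gp₁ U - DPDsY i parS₂ Gp₂ U).restrictScalars ℝ))
      (fun a a' => (Λ ^ 4 * B6.c1 dB δ₀ β ^ 2 *
          (κQ * κQ * θX * B₁ * BY + κQ * θQ * BX * B₁ * BY + κQ * κQ * BX * θC * BY + θQ * κQ * BX * B₁ * BY + κQ * κQ * BX * B₁ * θY)) *
        ((geo9K i).len a ^ 2)⁻¹ * Real.exp (-(ρ * (geo9K i).dist a a'))) := by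
  have hη : (kGeo i).eta ≠ 0 := eta_ne_zero i
  have hsq : |i.cf| ^ 2 = i.cf ^ 2 := sq_abs _
  have hlen : ∀ a : (geo9K i).Site, 0 < (geo9K i).len a := fun a => B6KLevelCensusIndexV1.len_pos i a
  have hdnn : ∀ a a' : (geo9K i).Site, 0 ≤ (geo9K i).dist a a' := geo9K_dist_nonneg i
  -- FILE 2a's engine on the realified letters
  have hE := hasMajorant_wordDiff349 (R := Rr) (H := Hp) (fun q : (Fin (d + 1) × SiteY i) × ι => ιB (blkOf i.D.toDomains q.1.2))
    (fun p : SiteY i × ι => ιB (blkOf i.D.toDomains p.1)) (fun q : BlkY i × ι => ιB q.1) dB δ₀ δ α β ρ Λ κQ θQ BX θX B₁ θC BY θY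
    hκQ hθQ hBX hθX hB₁ hθC hBY hθY hΛ hρ hα hβ hδ₀ hr hdnn htri hlen h261 hT1 hT4 hX₂ hdX hY₁ hdY hQ₁ hQ₂ hQs₁ hQs₂ hdQ hdQs hC₁ hC₂ hdC
  -- the two words between the derivative letters, as `conĵD ∘ conj b(W_j) ∘ conĵD*`
  rw [dWord_conj_eq b i hη, dWord_conj_eq b i hη, ← LinearMap.comp_sub, ← LinearMap.sub_comp, ← conj_sub] at hE
  have hW : ((Gp₁ U ∘ₗ QpsY i parS₁ U ∘ₗ XinvY i parS₁ Gp₁ U ∘ₗ QpY i parS₁ U ∘ₗ Gp₁ U).restrictScalars ℝ -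
      (Gp₂ U ∘ₗ QpsY i parS₂ U ∘ₗ XinvY i parS₂ Gp₂ U ∘ₗ QpY i parS₂ U ∘ₗ Gp₂ U).restrictScalars ℝ : Module.End ℝ (SiteY i → 𝔸)) =
      (Gp₁ U ∘ₗ QpsY i parS₁ U ∘ₗ XinvY i parS₁ Gp₁ U ∘ₗ QpY i parS₁ U ∘ₗ Gp₁ U
        - Gp₂ U ∘ₗ QpsY i parS₂ U ∘ₗ XinvY i parS₂ Gp₂ U ∘ₗ QpY i parS₂ U ∘ₗ Gp₂ U).restrictScalars ℝ :=
    LinearMap.ext fun _ => rfl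
  rw [hW] at hE
  -- relabel `(direction, site) ↔ bond` and read `conj b((D_U ∘ M ∘ D*_U)^ℝ)` (p38 g43's dictionary)
  have hM := hasMajorant_of_relabel (g := geo9K i) (Rr := Rr) (H := Hp) (bondRelabelY i ι)
    (blk := fun p : FBondY i × ι => ιB (blkOf i.D.toDomains (chartY i p.1.src)))
    (blk' := fun q : (Fin (d + 1) × SiteY i) × ι => ιB (blkOf i.D.toDomains q.1.2)) (fun _ => rfl)
    (fun μ x => conj_gradY_comp_divY_apply_eq b i U _ hsq μ x) hE
  -- (3.25)–(3.26): `D_UP₁D*_U − D_UP₂D*_U = D_U(W₁ − W₂)D*_U`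
  have e : ((DPDsY i parS₁ Gp₁ U - DPDsY i parS₂ Gp₂ U).restrictScalars ℝ : Module.End ℝ (FBondY i → 𝔸)) =
      (gradY i U ∘ₗ (Gp₁ U ∘ₗ QpsY i parS₁ U ∘ₗ XinvY i parS₁ Gp₁ U ∘ₗ QpY i parS₁ U ∘ₗ Gp₁ U
          - Gp₂ U ∘ₗ QpsY i parS₂ U ∘ₗ XinvY i parS₂ Gp₂ U ∘ₗ QpY i parS₂ U ∘ₗ Gp₂ U) ∘ₗ divY i U).restrictScalars ℝ := by
    rw [DPDsY_sub_eq]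
  rw [e]
  exact hM

/-- ★★★ the same majorant for `conj b((Δ_a(U;par₁,G′₁) − Δ_a(U;par₂,G′₂))^ℝ)` (a block majorant of `T` is one of `−T`). [cite: Balaban1985BackgroundPropagators, (3.26) p.395; Balaban1984PropagatorsII, (2.51) p.232] -/
theorem hasMajorant_conj_deltaAY_sub (parS₁ parS₂ : SiteParY 𝔸 i) (parB : BondParY 𝔸 i) (Gp₁ Gp₂ : SiteOpY 𝔸 i) (U : CfgY 𝔸 i) (Rr : ℝ) (Hp : Prop)
    [Fintype (geo9K i).Site] {K : (geo9K i).Site → (geo9K i).Site → ℝ}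
    (h : HasMajorant (g := toB6 (geo9K i) Rr Hp) (fun p : FBondY i × ι => ιB (blkV1 i.hN i.D p.1))
      (conj b ((DPDsY i parS₁ Gp₁ U - DPDsY i parS₂ Gp₂ U).restrictScalars ℝ)) K) :
    HasMajorant (g := toB6 (geo9K i) Rr Hp) (fun p : FBondY i × ι => ιB (blkV1 i.hN i.D p.1))
      (conj b ((deltaAY i parS₁ parB Gp₁ U - deltaAY i parS₂ parB Gp₂ U).restrictScalars ℝ)) K := by
  have e : ((deltaAY i parS₁ parB Gp₁ U - deltaAY i parS₂ parB Gp₂ U).restrictScalars ℝ : Module.End ℝ (FBondY i → 𝔸)) =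
      -((DPDsY i parS₁ Gp₁ U - DPDsY i parS₂ Gp₂ U).restrictScalars ℝ) := by
    rw [deltaAY_sub_eq_neg_DPDsY_sub]; exact LinearMap.ext fun _ => rfl
  rw [e, conj_neg]
  exact hasMajorant_neg (g := geo9K i) (R := Rr) (H := Hp) _ h

end Member

/-! ## §3  The weighted-sup-norm reading: `|TA|₍₋₃₎ ≤ κ′·|A|₍₋₁₎` from a block majorant `κ·ℓ(a)⁻²·e^{−ρd}` ((2.60) once, (2.61) once) -/

section Weighted

variable (i : KIdx d ℓ hd hL b₀ b₁) (ιB : BlkY i → IBondY i)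

omit [CompleteSpace 𝔸] in
/-- ★★ **FROM THE BLOCK MAJORANT TO THE (3.41) NORMS** — t2s-1's (Q1) currency.  If `conj b(T) ≺ κ·ℓ(a)⁻²·e^{−ρ·d(a,a′)}` over `(toB6 (geo9K i) Rr Hp, ιB∘blkV1)` (`ιB` a section
of `β`, `b` an ℝ-basis of `𝔸` with coordinate constant `M₂`), then for every bond function `A`: `|TA|₍₋₃₎ ≤ (κ·M₂·(Σ_j‖b_j‖)·Λ·c₁)·|A|₍₋₁₎` in def-Y's weighted sup norms
`wNormBY` ((3.41): `|Ψ|₍γ₎ = sup_j sup_{Ω_j}(Lʲη)^{−γ}|Ψ|`), where `Λ` transfers `ℓ(a′)⁻¹e^{−α₁δ₁d} ≤ Λℓ(a)⁻¹` ((2.60)), `c₁ = c₁(d_B, δ₂, α₂)` is the row constant of (2.61)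
and `α₁δ₁ + α₂δ₂ ≤ ρ`.  (Write `A = Σ_{y′}Δ(y′)A`; each piece is a class member of its own profile, bounded by `ℓ(y′)⁻¹|A|₍₋₁₎`; apply the majorant blockwise,
transfer `ℓ(y′)⁻¹` to `ℓ(y)⁻¹`, sum the row; the weight `(Lʲη)³ = ℓ(y)³` cancels `ℓ(y)⁻²·ℓ(y)⁻¹`.)
[cite: Balaban1985BackgroundPropagators, (3.39)–(3.42) p.397, (3.47) p.398; Balaban1984PropagatorsII, (2.51)–(2.52) p.232, Lemma 2.1 (2.60)–(2.61) p.234] -/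
theorem wNormBY_apply_le_of_hasMajorant [Fintype (geo9K i).Site] (hι : ∀ s, β i.hN i.D i.hk (ιB s) = s)
    {M₂ : ℝ} (hM₂ : 0 ≤ M₂) (hrepr : ∀ (v : 𝔸) (j : ι), |b.repr v j| ≤ M₂ * ‖v‖) (Rr : ℝ) (Hp : Prop)
    (T : Module.End ℝ (FBondY i → 𝔸)) {κ ρ : ℝ} (hκ : 0 ≤ κ)
    (h : HasMajorant (g := toB6 (geo9K i) Rr Hp) (fun p : FBondY i × ι => ιB (blkV1 i.hN i.D p.1)) (conj b T)
      (fun a a' => κ * ((geo9K i).len a ^ 2)⁻¹ * Real.exp (-(ρ * (geo9K i).dist a a'))))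
    (dB : ℕ) {δ₁ α₁ δ₂ α₂ Λ : ℝ} (hΛ : 0 ≤ Λ) (hT : ScaleTransfer (geo9K i) δ₁ α₁ Λ (fun a => ((geo9K i).len a)⁻¹))
    (h261 : Ineq261 dB (toB6 (geo9K i) Rr Hp) δ₂ α₂) (hsplit : α₁ * δ₁ + α₂ * δ₂ ≤ ρ) (A : FBondY i → 𝔸) :
    wNormBY i (-3) (T A) ≤ (κ * (M₂ * ∑ j, ‖b j‖) * Λ * B6.c1 dB δ₂ α₂) * wNormBY i (-1) A := by
  classical
  set W := wNormBY i (-1) A with hWdef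
  have hW : 0 ≤ W := by
    rw [hWdef]; unfold Node00.wNormBY
    exact B8ScaledSupNorm.msup_nonneg _ _ (inv_nonneg.2 (abs_nonneg _)) _ _ _
  have hSb : 0 ≤ ∑ j, ‖b j‖ := Finset.sum_nonneg fun j _ => norm_nonneg _
  have hc1 : 0 ≤ B6.c1 dB δ₂ α₂ := c1_nonneg dB δ₂ α₂
  have hC : 0 ≤ κ * (M₂ * ∑ j, ‖b j‖) * Λ * B6.c1 dB δ₂ α₂ := mul_nonneg (mul_nonneg (mul_nonneg hκ (mul_nonneg hM₂ hSb)) hΛ) hc1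
  refine wNormBY_le_of_pointwise i (mul_nonneg hC hW) fun e => ?_
  -- the bond `e`, its labelled block `y = ιB (blkV1 e)`, the weight `(Lʲη)^{−3} = ℓ(y)⁻³`
  have hly : 0 < (geo9K i).len (ιB (blkV1 i.hN i.D e)) := geo9K_len_pos i _
  have hw3 : (((ℓ : ℝ) + 1) ^ (blkV1 i.hN i.D e).1.1 * |i.cf|⁻¹) ^ (-3 : ℝ) = ((geo9K i).len (ιB (blkV1 i.hN i.D e)) ^ 3)⁻¹ := by
    rw [← len_blkB_eqK i ιB hι e, show (-3 : ℝ) = -((3 : ℕ) : ℝ) by norm_num, Real.rpow_neg hly.le, Real.rpow_natCast]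
  -- `A = Σ_{y′} Δ(y′)A`, `TA = Σ_{y′} T(Δ(y′)A)`
  let S : (geo9K i).Site → Set (FBondY i) := fun b' => {e' : FBondY i | ιB (blkV1 i.hN i.D e') = b'}
  have hTA : T A = ∑ b' : (geo9K i).Site, T (Set.indicator (S b') A) := by
    rw [← map_sum, sum_piece i ιB A]
  have hnorm : ‖T A e‖ ≤ ∑ b' : (geo9K i).Site, ‖T (Set.indicator (S b') A) e‖ := by
    rw [hTA, Finset.sum_apply]
    exact norm_sum_le _ _
  -- each piece: the majorant at the block `y′`, the piece bounded by `ℓ(y′)⁻¹·|A|₍₋₁₎`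
  have hpiece : ∀ b' : (geo9K i).Site, ‖T (Set.indicator (S b') A) e‖ ≤
      (∑ j, ‖b j‖) * ((κ * ((geo9K i).len (ιB (blkV1 i.hN i.D e)) ^ 2)⁻¹ * Real.exp (-(ρ * (geo9K i).dist (ιB (blkV1 i.hN i.D e)) b'))) *
        (M₂ * (((geo9K i).len b')⁻¹ * W))) := by
    intro b'
    have hKnn : 0 ≤ κ * ((geo9K i).len (ιB (blkV1 i.hN i.D e)) ^ 2)⁻¹ * Real.exp (-(ρ * (geo9K i).dist (ιB (blkV1 i.hN i.D e)) b')) :=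
      mul_nonneg (mul_nonneg hκ (inv_nonneg.2 (sq_nonneg _))) (Real.exp_pos _).le
    have hrhs : 0 ≤ (∑ j, ‖b j‖) * ((κ * ((geo9K i).len (ιB (blkV1 i.hN i.D e)) ^ 2)⁻¹ * Real.exp (-(ρ * (geo9K i).dist (ιB (blkV1 i.hN i.D e)) b'))) *
        (M₂ * (((geo9K i).len b')⁻¹ * W))) :=
      mul_nonneg hSb (mul_nonneg hKnn (mul_nonneg hM₂ (mul_nonneg (inv_nonneg.2 (geo9K_len_pos i b').le) hW)))
    by_cases hb : ∃ e' : FBondY i, ιB (blkV1 i.hN i.D e') = b'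
    · obtain ⟨e', he'⟩ := hb
      have hβ : ιB (β i.hN i.D i.hk b') = b' := by rw [← he', hι]
      -- the piece is a class member of its own profile, supported in `Δ(y′)`
      let J : FBondY i → ℝ := Set.indicator (S b') (fun w => ‖A w‖)
      have hΛ' : ∀ z, ‖Set.indicator (S b') A z‖ ≤ |J z| := by
        intro z
        by_cases hz : z ∈ S b'
        · simp only [J, Set.indicator_of_mem hz]; exact le_abs_self _
        · simp only [J, Set.indicator_of_notMem hz, norm_zero, abs_zero, le_refl]
      have h1 := norm_apply_le_of_hasMajorant_testYB i b (Rr := Rr) (Hp := Hp) T ιB hM₂ hrepr h J b' (suppIn_piece i ιB hι b' _)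
        (⟨Set.indicator (S b') A, hΛ'⟩ : TestY 𝔸 J) e
      rw [hβ] at h1
      refine h1.trans (mul_le_mul_of_nonneg_left (mul_le_mul_of_nonneg_left (mul_le_mul_of_nonneg_left ?_ hM₂) hKnn) hSb)
      -- `|Δ(y′)‖A‖| ≤ ℓ(y′)⁻¹·|‖A‖|₍₋₁₎ = ℓ(y′)⁻¹·|A|₍₋₁₎`
      have h2 := supNorm_piece_le i ιB hι b' (fun w => ‖A w‖) (-1)
      rw [Real.rpow_neg_one] at h2
      refine h2.trans (le_of_eq ?_)
      show ((geo9K i).len b')⁻¹ * B9GeoNormsKLevelV1.wNormB i (-1) (fun w => ‖A w‖) = ((geo9K i).len b')⁻¹ * W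
      rw [wNormB_norm_eq_wNormBY]
    · -- an empty piece
      have h0 : Set.indicator (S b') A = 0 := by
        funext z
        exact Set.indicator_of_notMem (show z ∉ S b' from fun hz => hb ⟨z, hz⟩) A
      rw [h0, map_zero, Pi.zero_apply, norm_zero]
      exact hrhs
  -- sum the row: split the rate, transfer `ℓ(y′)⁻¹`, (2.61)
  have hdnn : ∀ a a' : (geo9K i).Site, 0 ≤ (geo9K i).dist a a' := geo9K_dist_nonneg i
  have hrow : ∑ b' : (geo9K i).Site, Real.exp (-(ρ * (geo9K i).dist (ιB (blkV1 i.hN i.D e)) b')) * ((geo9K i).len b')⁻¹ ≤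
      Λ * ((geo9K i).len (ιB (blkV1 i.hN i.D e)))⁻¹ * B6.c1 dB δ₂ α₂ := by
    have hterm : ∀ b' : (geo9K i).Site, Real.exp (-(ρ * (geo9K i).dist (ιB (blkV1 i.hN i.D e)) b')) * ((geo9K i).len b')⁻¹ ≤
        Λ * ((geo9K i).len (ιB (blkV1 i.hN i.D e)))⁻¹ * Real.exp (-(α₂ * δ₂ * (geo9K i).dist (ιB (blkV1 i.hN i.D e)) b')) := by
      intro b'
      have hsp : Real.exp (-(ρ * (geo9K i).dist (ιB (blkV1 i.hN i.D e)) b')) ≤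
          Real.exp (-(α₁ * δ₁ * (geo9K i).dist (ιB (blkV1 i.hN i.D e)) b')) * Real.exp (-(α₂ * δ₂ * (geo9K i).dist (ιB (blkV1 i.hN i.D e)) b')) := by
        rw [← Real.exp_add]
        exact Real.exp_le_exp.2 (by nlinarith [hdnn (ιB (blkV1 i.hN i.D e)) b'])
      have ht := hT (ιB (blkV1 i.hN i.D e)) b'
      calc Real.exp (-(ρ * (geo9K i).dist (ιB (blkV1 i.hN i.D e)) b')) * ((geo9K i).len b')⁻¹
          ≤ Real.exp (-(α₁ * δ₁ * (geo9K i).dist (ιB (blkV1 i.hN i.D e)) b')) * Real.exp (-(α₂ * δ₂ * (geo9K i).dist (ιB (blkV1 i.hN i.D e)) b')) * ((geo9K i).len b')⁻¹ :=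
            mul_le_mul_of_nonneg_right hsp (inv_nonneg.2 (geo9K_len_pos i b').le)
        _ = Real.exp (-(α₁ * δ₁ * (geo9K i).dist (ιB (blkV1 i.hN i.D e)) b')) * ((geo9K i).len b')⁻¹ * Real.exp (-(α₂ * δ₂ * (geo9K i).dist (ιB (blkV1 i.hN i.D e)) b')) := by ring
        _ ≤ Λ * ((geo9K i).len (ιB (blkV1 i.hN i.D e)))⁻¹ * Real.exp (-(α₂ * δ₂ * (geo9K i).dist (ιB (blkV1 i.hN i.D e)) b')) :=
            mul_le_mul_of_nonneg_right ht (Real.exp_pos _).le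
    calc ∑ b' : (geo9K i).Site, Real.exp (-(ρ * (geo9K i).dist (ιB (blkV1 i.hN i.D e)) b')) * ((geo9K i).len b')⁻¹
        ≤ ∑ b' : (geo9K i).Site, Λ * ((geo9K i).len (ιB (blkV1 i.hN i.D e)))⁻¹ * Real.exp (-(α₂ * δ₂ * (geo9K i).dist (ιB (blkV1 i.hN i.D e)) b')) := Finset.sum_le_sum fun b' _ => hterm b'
      _ = Λ * ((geo9K i).len (ιB (blkV1 i.hN i.D e)))⁻¹ * ∑ b' : (geo9K i).Site, Real.exp (-(α₂ * δ₂ * (geo9K i).dist (ιB (blkV1 i.hN i.D e)) b')) := by rw [Finset.mul_sum]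
      _ ≤ Λ * ((geo9K i).len (ιB (blkV1 i.hN i.D e)))⁻¹ * B6.c1 dB δ₂ α₂ :=
          mul_le_mul_of_nonneg_left (h261 _) (mul_nonneg hΛ (inv_nonneg.2 hly.le))
  -- assemble
  have hsum : ‖T A e‖ ≤ (∑ j, ‖b j‖) * κ * M₂ * W * ((geo9K i).len (ιB (blkV1 i.hN i.D e)) ^ 2)⁻¹ * (Λ * ((geo9K i).len (ιB (blkV1 i.hN i.D e)))⁻¹ * B6.c1 dB δ₂ α₂) := by
    refine hnorm.trans ((Finset.sum_le_sum fun b' _ => hpiece b').trans ?_)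
    have hre : ∀ b' : (geo9K i).Site,
        (∑ j, ‖b j‖) * ((κ * ((geo9K i).len (ιB (blkV1 i.hN i.D e)) ^ 2)⁻¹ * Real.exp (-(ρ * (geo9K i).dist (ιB (blkV1 i.hN i.D e)) b'))) *
          (M₂ * (((geo9K i).len b')⁻¹ * W))) =
          (∑ j, ‖b j‖) * κ * M₂ * W * ((geo9K i).len (ιB (blkV1 i.hN i.D e)) ^ 2)⁻¹ * (Real.exp (-(ρ * (geo9K i).dist (ιB (blkV1 i.hN i.D e)) b')) * ((geo9K i).len b')⁻¹) := by
      intro b'; ring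
    simp_rw [hre]
    rw [← Finset.mul_sum]
    exact mul_le_mul_of_nonneg_left hrow
      (mul_nonneg (mul_nonneg (mul_nonneg (mul_nonneg hSb hκ) hM₂) hW) (inv_nonneg.2 (sq_nonneg _)))
  rw [hw3]
  refine hsum.trans (le_of_eq ?_)
  field_simp

end Weighted


end Literature.MathematicalPhysics.QuantumFieldTheory.Balaban1983to89.B9B8KnitBondWordDiff

end
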